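import Summits.BirchSwinnertonDyer.Rank1Residual.X11b.BDPRouteLocalKernelBound
import Summits.BirchSwinnertonDyer.Rank1Residual.X11b.AnticyclotomicControlNPlus
import Summits.BirchSwinnertonDyer.Rank1Residual.X11b.AnticyclotomicLocalTorsionDescent
import Summits.BirchSwinnertonDyer.Rank1Residual.X11b.BDPRouteRecordFinal
import HarnessLib

/-!
# Class X11b, route p2: the one-sided control input (CTL≤)ᵗ from the BAD-PLACE data ONLY —
# away descent DISCHARGED by the sibling's gen 11 (good places: Greenberg L3.3; inert/ramified
# places split completely in `K_∞^{ac}`) (cell `b2b-bsdres`, sub-cell `multr1-p2`, gen 13)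

HONEST FRAMING (verbatim, cell `b2b-bsdres`): the goal of the cell is to DELETE the
COMBINATION-SHAPED residual classes for ALL analytic-rank `≤ 1` curves over `ℚ` — "full BSD
formula for every rank `≤ 1` curve in class `C`" assembled STRICTLY from published theorems — so
that the rank-`≤ 1` remainder becomes exactly the CONSTRUCTION-SHAPED classes, which are TYPED
(missing-input Props), NOT attempted; this is not "finishing BSD". Research route `p2` for class
X11b; no claim beyond the stated class; nothing booked; X11b stays CONSTRUCTION-SHAPED. Theorems
only; no definition, no named fact, no `sorry`. Joins this sub-cell's gen-13 chain
(`BDPRouteControlSnake` → `BDPRouteLocalKernelBound`: the counting snake lemma and the bad-place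
end form) with the sibling sub-cell's gen 11 (`AnticyclotomicControlSplitImprimitive`,
`AnticyclotomicControlNPlus`: `away_descent_of_splitBad_subset` — at every finite `v ∤ p` off the
places above `N⁺` the away condition descends, kernel-proved; `nPlusPlaces` = `Σ(N⁺)`, finite).

## Content

* **`controlUpperOnTreeAt_of_splitBad_bounds`** — for `E/ℚ` over a quadratic totally complex `K`, an
  ANTICYCLOTOMIC `κ` with generator `γ`, `𝔭` with `E(K̄)[p^∞]^{D_𝔭 ⊓ ker κ} = 0`, and a finite `T`
  containing the bad places `v ∤ p` over split primes: route p2's input `ControlUpperOnTreeAt p κ 𝔭 γ ι P`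
  follows from (c) `#ker r_v ≤ p^{b v}` on `T` and (d) `#Sel_𝔭(K, E[p^∞]) ≤ p^a`, with
  `a + Σ_{v∈T} b v ≤ ord_p #Ш(E/K)[p^∞] + 2((ord_p log_ω P − 1) − ord_p[E(K):ℤP]) + ord_p ∏_{w∣N⁺} c_w`
  — NO descent hypothesis left (the sibling's `away_descent_of_splitBad_subset`).
* **`controlUpperOnTreeAt_of_nPlus_bounds`** — the same with `T = Σ(N⁺)` (`nPlusPlaces`, finite).
* **`p2ControlUpperOnTreeAt_of_badPlaces_bounds`** — CLASS LEVEL: the typed input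
  `P2ControlUpperOnTreeAt W p` of the statement of record (`P2.bsdp_of_onTree_weakest`) follows from
  the erratum's hypothesis (iv) `E(ℚ_p)[p] = 0` (sibling's descent along `K_𝔭 ≅ ℚ_p`) and, at every p2 datum, the package
  "(c) on `Σ(N⁺)` + (d)" — stated inline, no new predicate. In print: (c) = Greenberg Lemma 3.3 at
  the bad `w ∤ p` (`#ker r_w = c_w^{(p)}`; after `BDPRouteLocalKernelBound` = four facts about `E₀`),
  (d) = Cas18 (3.2.1)+(calcul) in `≤` form (JSW Prop. 3.2.1; Poitou–Tate). These two are now the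
  WHOLE residue of (CTL≤)ᵗ on the (iv)-part of X11b.

CONDITIONAL; nothing booked; reach and labels unchanged.

References: [Castella2018] Thm. 2.3 and its proof (arXiv:1704.06608 pp. 5–6); [GreenbergLNM1716]
§3 Lemma 3.3 (p. 87), p. 90; [JetchevSkinnerWan2017] Prop. 3.2.1, §3.3 (shape only);
[Castella2018Erratum] Thm. 1.1 (iv).
-/

noncomputable section

open scoped Classical

open NumberField IsDedekindDomain Field WeierstrassCurve
open Literature.NumberTheory.EllipticCurves Literature.NumberTheory.EllipticCurves.GreenbergSelmer
open Literature.NumberTheory.GaloisRepresentations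
open Literature.NumberTheory.EllipticCurves.Rank1Residual
open Literature.NumberTheory.QuadraticFields.Quadratic

namespace Summit.BirchSwinnertonDyer.Rank1Residual.X11b

open AcSelmer

section Datum

variable {W : WeierstrassCurve ℚ} [W.IsElliptic] [W.IsGloballyMinimal] {K : Type} [Field K]
  [NumberField K] {p : ℕ} [Fact p.Prime] {κ : ZpExtension K p} {𝔭 : HeightOneSpectrum (𝓞 K)}
  {γ : Field.absoluteGaloisGroup K} [Fact (κ.IsTopGenerator γ)] {ι : K →+* ℚ_[p]}

/-- **(CTL≤)ᵗ at a datum from the bad-place data only.** For `E/ℚ` over a quadratic totally complex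
`K`, an anticyclotomic `ℤ_p`-extension `κ` with topological generator `γ`, `𝔭` with
`E(K̄)[p^∞]^{D_𝔭 ⊓ ker κ} = 0`, and a finite set `T` of places `v ∤ p` containing every bad place over
a split prime: `ControlUpperOnTreeAt p κ 𝔭 γ ι P` follows from (c) finiteness and bounds
`#ker r_v ≤ p^{b v}` on `T`, (d) `#Sel_𝔭(K, E[p^∞]) ≤ p^a`, and the arithmetic
`a + Σ_{v∈T} b v ≤ ord_p #Ш(E/K)[p^∞] + 2((ord_p log_ω P − 1) − ord_p[E(K):ℤP]) + ord_p ∏_{w∣N⁺} c_w`.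
The away descent off `T` is the sibling's kernel theorem `away_descent_of_splitBad_subset`.
[cite: Castella2018, Thm. 2.3 and its proof (arXiv:1704.06608 pp. 5–6)]
[cite: GreenbergLNM1716, §3 Lemma 3.3 (p. 87), p. 90] -/
theorem controlUpperOnTreeAt_of_splitBad_bounds [IsTotallyComplex K] (hK : Module.finrank ℚ K = 2)
    (hκ : κ.IsAnticyclotomic)
    (h0 : FixedPoints.addSubgroup ↥(decomp 𝔭 ⊓ κ.kerSubgroup)
      ((W.baseChange K).geomPrimaryTorsion p) = ⊥)
    (T : Finset (HeightOneSpectrum (𝓞 K))) (hTp : ∀ v ∈ T, ((p : ℕ) : 𝓞 K) ∉ v.asIdeal)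
    (hTbad : ∀ v : HeightOneSpectrum (𝓞 K), ((p : ℕ) : 𝓞 K) ∉ v.asIdeal →
      ¬ (W.baseChange K).HasGoodReductionAt v →
        v.asIdeal.ramificationIdx (𝓞 ℚ) = 1 → v.asIdeal.inertiaDeg (𝓞 ℚ) = 1 → v ∈ T)
    [Finite (selmerAcBase (W.baseChange K) p 𝔭 ∅)]
    (hfin : ∀ v ∈ T, Finite (localKer κ.kerSubgroup ((W.baseChange K).geomPrimaryTorsion p) v))
    {a : ℕ} (ha : Nat.card (selmerAcBase (W.baseChange K) p 𝔭 ∅) ≤ p ^ a)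
    {b : HeightOneSpectrum (𝓞 K) → ℕ}
    (hb : ∀ v ∈ T,
      Nat.card (localKer κ.kerSubgroup ((W.baseChange K).geomPrimaryTorsion p) v) ≤ p ^ b v)
    {P : (W.baseChange K).toAffine.Point}
    (hm : ((a + ∑ v ∈ T, b v : ℕ) : ℤ) ≤ (padicValNat p
        (Nat.card (AddCommGroup.primaryComponent (W.baseChange K).sha p)) : ℤ) +
      2 * ((padicLogOrd W p ι P - 1) - (padicValNat p (AddSubgroup.zmultiples P).index : ℤ)) +
        padicValNat p (tamagawaProductSplit W K)) :
    ControlUpperOnTreeAt p κ 𝔭 γ ι P :=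
  controlUpperOnTreeAt_of_localKer_bounds h0 T hTp
    (fun c hc v hv _ hvT ↦ away_descent_of_splitBad_subset (W.baseChange K) p κ 𝔭
      (↑T : Set (HeightOneSpectrum (𝓞 K))) hK hκ
      (fun v' hpv hbad he hf ↦ Finset.mem_coe.mpr (hTbad v' hpv hbad he hf)) c
      (selmerAc_empty_le hc) v hv (fun h ↦ hvT (Finset.mem_coe.mp h)))
    hfin ha hb hm

/-- **(CTL≤)ᵗ at a datum from the data on `Σ(N⁺)`** (`T = nPlusPlaces W K p`, the places `v ∤ p`
above the split `ℓ ∣ N_E`; finite for quadratic `K`): route p2's control input follows from (c) the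
local kernel bounds on `Σ(N⁺)` and (d) one bound on `#Sel_𝔭(K, E[p^∞])`, nothing else.
[cite: Castella2018, §2.1 (N = N⁺N⁻) and Thm. 2.3 (arXiv:1704.06608 p. 5)]
[cite: GreenbergLNM1716, §3 Lemma 3.3 (p. 87), p. 90] -/
theorem controlUpperOnTreeAt_of_nPlus_bounds [IsTotallyComplex K] (hK : Module.finrank ℚ K = 2)
    (hκ : κ.IsAnticyclotomic)
    (h0 : FixedPoints.addSubgroup ↥(decomp 𝔭 ⊓ κ.kerSubgroup)
      ((W.baseChange K).geomPrimaryTorsion p) = ⊥)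
    [Finite (selmerAcBase (W.baseChange K) p 𝔭 ∅)]
    (hfin : ∀ v ∈ (nPlusPlaces_finite (W := W) (K := K) (p := p) hK).toFinset,
      Finite (localKer κ.kerSubgroup ((W.baseChange K).geomPrimaryTorsion p) v))
    {a : ℕ} (ha : Nat.card (selmerAcBase (W.baseChange K) p 𝔭 ∅) ≤ p ^ a)
    {b : HeightOneSpectrum (𝓞 K) → ℕ}
    (hb : ∀ v ∈ (nPlusPlaces_finite (W := W) (K := K) (p := p) hK).toFinset,
      Nat.card (localKer κ.kerSubgroup ((W.baseChange K).geomPrimaryTorsion p) v) ≤ p ^ b v)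
    {P : (W.baseChange K).toAffine.Point}
    (hm : ((a + ∑ v ∈ (nPlusPlaces_finite (W := W) (K := K) (p := p) hK).toFinset, b v : ℕ) : ℤ) ≤
      (padicValNat p (Nat.card (AddCommGroup.primaryComponent (W.baseChange K).sha p)) : ℤ) +
      2 * ((padicLogOrd W p ι P - 1) - (padicValNat p (AddSubgroup.zmultiples P).index : ℤ)) +
        padicValNat p (tamagawaProductSplit W K)) :
    ControlUpperOnTreeAt p κ 𝔭 γ ι P :=
  controlUpperOnTreeAt_of_splitBad_bounds hK hκ h0 _
    (fun _ hv ↦ (((nPlusPlaces_finite (W := W) (K := K) (p := p) hK).mem_toFinset).mp hv).1)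
    (fun v hpv hbad he hf ↦ ((nPlusPlaces_finite (W := W) (K := K) (p := p) hK).mem_toFinset).mpr
      (mem_nPlusPlaces_of v hpv
        (primesEquiv_under_dvd_conductorNorm_of_not_hasGoodReductionAt K v hbad) he hf))
    hfin ha hb hm

end Datum

/-! ## Class level: `P2ControlUpperOnTreeAt` from (iv) and the per-datum package "(c) on Σ(N⁺) + (d)" -/

section ClassLevel

variable {W : WeierstrassCurve ℚ} [W.IsElliptic] [W.IsGloballyMinimal] {p : ℕ} [Fact p.Prime]

/-- **The typed input (T1ᵗ-CTL≤) of the statement of record from (iv) + bad-place data + one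
Selmer bound.** `P2ControlUpperOnTreeAt W p` (Cas18 Thm. 2.3 `≤`, PUB shape, the input of
`P2.bsdp_of_onTree_weakest`) follows from the erratum's hypothesis (iv) `E(ℚ_p)[p] = 0` (every
`ℚ_p`-point killed by `p` is zero; the sibling's descent along `K_𝔭 ≅ ℚ_p`,
`noPTorsion_baseChange_adicCompletion_of_padic` + `eq_zero_of_fixed_decomp_of_local`)
together with, at every p2 datum (Heegner field `K`, anticyclotomic `κ`, generator `γ`, degree-one
`𝔭 ∣ p`, Heegner point `P`): finiteness of `Sel_𝔭(K, E[p^∞])` and of the `ker r_v` on `Σ(N⁺)`,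
bounds `#Sel_𝔭(K, E[p^∞]) ≤ p^a`, `#ker r_v ≤ p^{b v}`, and
`a + Σ_{v∈Σ(N⁺)} b v ≤ ord_p #Ш(E/K)[p^∞] + 2((ord_p log_ω P − 1) − ord_p[E(K):ℤP]) + ord_p ∏_{w∣N⁺} c_w`.
In print the package is Greenberg Lemma 3.3 at the bad `w ∤ p` (`b w = ord_p c_w`) and Cas18
(3.2.1)+(calcul) (`a = ord_p #Ш + 2(ord_p c_p + ord_p log_ω P − 1 − ord_p I)`); it is a HYPOTHESIS
here (stated inline; no predicate, nothing asserted). CONDITIONAL; nothing booked.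
[cite: Castella2018, Thm. 2.3 and its proof (arXiv:1704.06608 pp. 5–6)]
[cite: Castella2018Erratum, Thm. 1.1 (iv)] [cite: GreenbergLNM1716, §3 Lemma 3.3 (p. 87)] -/
theorem p2ControlUpperOnTreeAt_of_badPlaces_bounds
    (hiv : ∀ Q : (W.baseChange ℚ_[p]).toAffine.Point, p • Q = 0 → Q = 0)
    (hpkg : ∀ (K : Type) [Field K] [NumberField K] (hK : IsImaginaryQuadratic K)
      (κ : ZpExtension K p), κ.IsAnticyclotomic →
      ∀ (γ : Field.absoluteGaloisGroup K) [Fact (κ.IsTopGenerator γ)]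
        (𝔭 : HeightOneSpectrum (𝓞 K)) (h𝔭 : ((p : ℕ) : 𝓞 K) ∈ 𝔭.asIdeal)
        (he : 𝔭.asIdeal.ramificationIdx (𝓞 ℚ) = 1) (hf : 𝔭.asIdeal.inertiaDeg (𝓞 ℚ) = 1)
        (P : (W.baseChange K).toAffine.Point), ¬ IsOfFinAddOrder P →
        ∃ (_ : Finite (selmerAcBase (W.baseChange K) p 𝔭 ∅)) (a : ℕ)
          (b : HeightOneSpectrum (𝓞 K) → ℕ),
          (∀ v ∈ (nPlusPlaces_finite (W := W) (K := K) (p := p) hK.1).toFinset,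
            Finite (localKer κ.kerSubgroup ((W.baseChange K).geomPrimaryTorsion p) v)) ∧
          Nat.card (selmerAcBase (W.baseChange K) p 𝔭 ∅) ≤ p ^ a ∧
          (∀ v ∈ (nPlusPlaces_finite (W := W) (K := K) (p := p) hK.1).toFinset,
            Nat.card (localKer κ.kerSubgroup ((W.baseChange K).geomPrimaryTorsion p) v) ≤
              p ^ b v) ∧
          ((a + ∑ v ∈ (nPlusPlaces_finite (W := W) (K := K) (p := p) hK.1).toFinset, b v : ℕ) :
              ℤ) ≤
            (padicValNat p (Nat.card (AddCommGroup.primaryComponent (W.baseChange K).sha p)) : ℤ) +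
            2 * ((padicLogOrd W p (embAt K p 𝔭 h𝔭 he hf) P - 1) -
              (padicValNat p (AddSubgroup.zmultiples P).index : ℤ)) +
              padicValNat p (tamagawaProductSplit W K)) :
    P2ControlUpperOnTreeAt W p := by
  intro N _ K _ _ Dt H ι P _ _ _ _ hK _ _ _ _ _ _ _ hPinf κ hκ γ _ 𝔭 h𝔭 he hf
  haveI : IsTotallyComplex K := hK.2
  obtain ⟨hfinK, a, b, hfin, ha, hb, hm⟩ := hpkg K hK κ hκ γ 𝔭 h𝔭 he hf P hPinf
  haveI := hfinK
  -- (iv) ⟹ `E(K̄)[p^∞]^{D_𝔭 ⊓ ker κ} = 0` (the sibling's descent along `K_𝔭 ≅ ℚ_p`)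
  obtain ⟨e⟩ := exists_ringHom_adicCompletion_padic_of_degreeOne p 𝔭 h𝔭 he hf
  have hKv := noPTorsion_baseChange_adicCompletion_of_padic W p 𝔭 e hiv
  have h0 : FixedPoints.addSubgroup ↥(decomp 𝔭 ⊓ κ.kerSubgroup)
      ((W.baseChange K).geomPrimaryTorsion p) = ⊥ := by
    refine fixedPoints_decomp_inf_kerSubgroup_eq_bot κ (W.baseChange K) 𝔭 fun m hfix hpm ↦
      eq_zero_of_fixed_decomp_of_local (W.baseChange K) p 𝔭 ?_ m hfix hpm
    exact hKv
  exact controlUpperOnTreeAt_of_nPlus_bounds hK.1 hκ h0 hfin ha hb hm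

end ClassLevel

end Summit.BirchSwinnertonDyer.Rank1Residual.X11b

end
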